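import Summits.RiemannHypothesis.RiemannHypothesis.Theses.RuelleBand
import Literature.NumberTheory.LFunctions.WeilZeroSum
import HarnessLib

/-!
# RiemannHypothesis / RuelleBand — calibration of the heat cone: `ExactFirstBand` implies positivity of the zero heat trace

Route `RiemannHypothesis/RuelleBand`, crux item stmt-RiemannHypothesis-2061 (`ExactFirstBand`),
line `Sketch` (heat cone), stub `stub_exact_heatPD` (helper file, `--supports`; the CALIBRATION /
honesty stub, not used in the composition).

**Statement.** Write `m(ρ) = riemannZetaZeroOrder ρ` for the multiplicity of a non-trivial zero
`ρ ∈ ZetaZeros.riemannZetaNontrivialZeros` (`= {ζ = 0} ∩ {0 < re < 1}`) and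
`Z(t) = Σ'_ρ m(ρ) e^{-t ρ(1-ρ)}` for the zero heat trace.  Assume
(1) for every `t > 0` the real series `Σ_ρ m(ρ) e^{-t Re(ρ(1-ρ))}` is summable, and
(2) `ExactFirstBand`: every zero of `ζ` in the open critical strip has `Re ρ = 1/2` or `Im ρ = 0`.
Then `t ↦ Re Z(t)` is positive definite on the semigroup `((0,∞),+)`: for all `n`, all `s_a > 0`
and all real `c_a`, `0 ≤ Σ_a Σ_b c_a c_b Re Z(s_a + s_b)`.

**Proof.** Under (2) each Casimir parameter `λ_ρ = ρ(1-ρ)` is real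
(`Im(ρ(1-ρ)) = Im ρ · (1 - 2 Re ρ)`), so every summand `m(ρ) e^{-u ρ(1-ρ)}` (`u` real) is the real
number `m(ρ) e^{-u λ_ρ}` and `Re Z(u) = Σ'_ρ m(ρ) e^{-u λ_ρ}` (`Complex.ofReal_tsum`).  By (1) at
`t = s_a + s_b > 0` the finite double sum commutes with the series (`Summable.tsum_finsetSum`,
`tsum_mul_left`), and `e^{-(s_a+s_b)λ} = e^{-s_a λ} e^{-s_b λ}` turns the summand into
`m(ρ) (Σ_a c_a e^{-s_a λ_ρ})² ≥ 0` (`m(ρ) ≥ 0` by `riemannZetaZeroOrder_nonneg`); conclude with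
`tsum_nonneg`.  So the line's bet (positive definiteness of the heat trace) is implied by the crux:
it carries no hidden strengthening.

Mathlib + `Literature.NumberTheory.LFunctions.WeilZeroSum` (membership API of the non-trivial zeros)
only; no named fact is used; no definitions.
-/

set_option linter.dupNamespace false

noncomputable section

open Complex
open scoped BigOperators

namespace Summit.RiemannHypothesis.RiemannHypothesis.Theorems.RuelleBandExactFirstBand

open Literature.NumberTheory.LFunctions
open Summit.RiemannHypothesis.RiemannHypothesis.Theses.RuelleBand

/-! ### The algebraic core: a positive combination of real exponentials is exponentially convex -/

/-- **Algebraic core.** For non-negative weights `w i`, real exponents `l i` and positive times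
`s a`, if `Σ_i w i e^{-t l i}` is summable for every `t > 0`, then
`0 ≤ Σ_a Σ_b c_a c_b Σ'_i w i e^{-(s_a + s_b) l i}`: the double sum equals
`Σ'_i w i (Σ_a c_a e^{-s_a l i})²`. [folklore] -/
theorem stub_exact_heatPD_real {ι : Type*} (w l : ι → ℝ) (hw : ∀ i, 0 ≤ w i)
    (hsum : ∀ t : ℝ, 0 < t → Summable (fun i => w i * Real.exp (-(t * l i))))
    {n : ℕ} (s c : Fin n → ℝ) (hs : ∀ a, 0 < s a) :
    0 ≤ ∑ a, ∑ b, c a * c b * ∑' i, w i * Real.exp (-((s a + s b) * l i)) := by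
  have hsum' : ∀ a b, Summable (fun i => c a * c b * (w i * Real.exp (-((s a + s b) * l i)))) :=
    fun a b => (hsum _ (add_pos (hs a) (hs b))).mul_left _
  have h1 : ∀ a, ∑ b, c a * c b * ∑' i, w i * Real.exp (-((s a + s b) * l i)) =
      ∑' i, ∑ b, c a * c b * (w i * Real.exp (-((s a + s b) * l i))) := by
    intro a
    rw [Summable.tsum_finsetSum (fun b _ => hsum' a b)]
    simp_rw [tsum_mul_left]
  have h2 : ∑ a, ∑ b, c a * c b * ∑' i, w i * Real.exp (-((s a + s b) * l i)) =
      ∑' i, ∑ a, ∑ b, c a * c b * (w i * Real.exp (-((s a + s b) * l i))) := by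
    simp_rw [h1]
    rw [Summable.tsum_finsetSum (fun a _ => summable_sum fun b _ => hsum' a b)]
  rw [h2]
  refine tsum_nonneg fun i => ?_
  have h3 : ∑ a, ∑ b, c a * c b * (w i * Real.exp (-((s a + s b) * l i))) =
      w i * (∑ a, c a * Real.exp (-(s a * l i))) ^ 2 := by
    rw [sq, Finset.sum_mul_sum, Finset.mul_sum]
    refine Finset.sum_congr rfl fun a _ => ?_
    rw [Finset.mul_sum]
    refine Finset.sum_congr rfl fun b _ => ?_
    rw [add_mul, neg_add, Real.exp_add]
    ring
  rw [h3]
  exact mul_nonneg (hw i) (sq_nonneg _)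

/-! ### Under `ExactFirstBand` the heat trace is a real Dirichlet series -/

/-- Under `ExactFirstBand`, the Casimir parameter `ρ(1-ρ)` of every non-trivial zero `ρ` is real:
`Im(ρ(1-ρ)) = Im ρ · (1 - 2 Re ρ)` vanishes if `Re ρ = 1/2` or `Im ρ = 0`. [folklore] -/
theorem stub_exact_heatPD_casimir_im (hX : ExactFirstBand)
    (ρ : ZetaZeros.riemannZetaNontrivialZeros) : ((ρ : ℂ) * (1 - (ρ : ℂ))).im = 0 := by
  obtain ⟨hζ, h0, h1⟩ := ZetaZeros.riemannZetaNontrivialZeros.mem_iff'.1 ρ.2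
  have him : ((ρ : ℂ) * (1 - (ρ : ℂ))).im = (ρ : ℂ).im * (1 - 2 * (ρ : ℂ).re) := by
    simp only [Complex.mul_im, Complex.sub_re, Complex.one_re, Complex.sub_im, Complex.one_im]
    ring
  rw [him]
  rcases hX _ hζ h0 h1 with h | h
  · rw [h]; ring
  · rw [h, zero_mul]

/-- Under `ExactFirstBand`, each summand `m(ρ) e^{-u ρ(1-ρ)}` of the heat trace at a real time `u`
is the real number `m(ρ) e^{-u Re(ρ(1-ρ))}`. [folklore] -/
theorem stub_exact_heatPD_term (hX : ExactFirstBand) (u : ℝ)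
    (ρ : ZetaZeros.riemannZetaNontrivialZeros) :
    (riemannZetaZeroOrder (ρ : ℂ) : ℂ) * cexp (-((u : ℂ) * ((ρ : ℂ) * (1 - (ρ : ℂ))))) =
      (((riemannZetaZeroOrder (ρ : ℂ) : ℝ) *
        Real.exp (-(u * ((ρ : ℂ) * (1 - (ρ : ℂ))).re)) : ℝ) : ℂ) := by
  have hreal : (ρ : ℂ) * (1 - (ρ : ℂ)) = ((((ρ : ℂ) * (1 - (ρ : ℂ))).re : ℝ) : ℂ) :=
    Complex.ext (by simp) (by simp [stub_exact_heatPD_casimir_im hX ρ])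
  rw [hreal, Complex.ofReal_re]
  push_cast
  rfl

/-- Under `ExactFirstBand`, the real part of the heat trace at a real time `u` is the real series
`Σ'_ρ m(ρ) e^{-u Re(ρ(1-ρ))}` (no summability needed: `Complex.ofReal_tsum`). [folklore] -/
theorem stub_exact_heatPD_re_tsum (hX : ExactFirstBand) (u : ℝ) :
    (∑' ρ : ZetaZeros.riemannZetaNontrivialZeros,
        (riemannZetaZeroOrder (ρ : ℂ) : ℂ) * cexp (-((u : ℂ) * ((ρ : ℂ) * (1 - (ρ : ℂ)))))).re =
      ∑' ρ : ZetaZeros.riemannZetaNontrivialZeros,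
        (riemannZetaZeroOrder (ρ : ℂ) : ℝ) * Real.exp (-(u * ((ρ : ℂ) * (1 - (ρ : ℂ))).re)) := by
  simp_rw [stub_exact_heatPD_term hX u]
  rw [← Complex.ofReal_tsum, Complex.ofReal_re]

/-! ### The calibration stub -/

/-- **Stub `stub_exact_heatPD` (calibration / honesty: the crux implies the bet).** Assume the real
heat series `Σ_ρ m(ρ) e^{-t Re(ρ(1-ρ))}` over the non-trivial zeros is summable for every `t > 0`, and
`ExactFirstBand` (every zero of `ζ` in the open strip has `Re ρ = 1/2` or `Im ρ = 0`).  Then the zero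
heat trace `Z(t) = Σ'_ρ m(ρ) e^{-t ρ(1-ρ)}` has positive-definite real part on `((0,∞),+)`:
`0 ≤ Σ_a Σ_b c_a c_b Re Z(s_a + s_b)` for all `s_a > 0`, `c_a ∈ ℝ`.  Indeed every `ρ(1-ρ)` is real,
so `Re Z(u) = Σ'_ρ m(ρ) e^{-u ρ(1-ρ)}` and the form is `Σ'_ρ m(ρ) (Σ_a c_a e^{-s_a ρ(1-ρ)})² ≥ 0`.
[folklore] -/
theorem stub_exact_heatPD :
    (∀ t : ℝ, 0 < t → Summable (fun ρ : ZetaZeros.riemannZetaNontrivialZeros =>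
      (riemannZetaZeroOrder (ρ : ℂ) : ℝ) * Real.exp (-(t * ((ρ : ℂ) * (1 - (ρ : ℂ))).re)))) →
    ExactFirstBand →
    ∀ (n : ℕ) (s c : Fin n → ℝ), (∀ a, 0 < s a) →
      0 ≤ ∑ a, ∑ b, c a * c b *
        (∑' ρ : ZetaZeros.riemannZetaNontrivialZeros,
          (riemannZetaZeroOrder (ρ : ℂ) : ℂ) * cexp (-(((s a + s b : ℝ) : ℂ) * ((ρ : ℂ) * (1 - (ρ : ℂ)))))).re := by
  intro hS hX n s c hs
  simp_rw [stub_exact_heatPD_re_tsum hX]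
  exact stub_exact_heatPD_real
    (fun ρ : ZetaZeros.riemannZetaNontrivialZeros => (riemannZetaZeroOrder (ρ : ℂ) : ℝ))
    (fun ρ : ZetaZeros.riemannZetaNontrivialZeros => ((ρ : ℂ) * (1 - (ρ : ℂ))).re)
    (fun ρ => Int.cast_nonneg
      (riemannZetaZeroOrder_nonneg (ZetaZeros.riemannZetaNontrivialZeros.ne_one ρ.2)))
    hS s c hs

end Summit.RiemannHypothesis.RiemannHypothesis.Theorems.RuelleBandExactFirstBand

end
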